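import Mathlib

/-!
# Tier4/Common/HaarProductTransport — Haar measure along a continuous isomorphism `G ≃ₜ* H₁ × H₂`: the product of
Haar measures is Haar, Haar uniqueness pins the scalar, and the integral splits as an iterated integral

Blind re-derivation cell `pub-hodge-repro`, Tier 4 (README §9–§10), seat t4-typer-1 (gen 2).  Target tree path
`lean/Summits/Ventures/HodgeRepro/Tier4/Common/HaarProductTransport.lean`.  Imports Mathlib only.

WHAT IS TYPED — the GENERIC half of plan-4's cut C-L4-TORUSPROD (S14382 (5)–(7); the `T′` twins of S14422 are the same
three statements at a second isomorphism), for ANY continuous group isomorphism `e : G ≃ₜ* H₁ × H₂` of Hausdorff topological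
groups with Borel σ-algebras (locally compact and second countable where Haar uniqueness / σ-finiteness need it):
* (5) **`isHaarMeasure_map_symm_prod`**: for Haar measures `ν₁`, `ν₂` the push-forward `Measure.map e.symm (ν₁.prod ν₂)` is a
  Haar measure on `G` (Mathlib: `prod.instIsHaarMeasure`, `ContinuousMulEquiv.isHaarMeasure_map`; the measurability of
  `e.symm` is its continuity on Borel spaces — the junk of S14382 (5), `Measure.map` of a non-measurable map being `0`,
  is answered by the instance, not assumed);
* (6) **`exists_smul_map_symm_prod_eq`**: a Haar measure `μ` on `G` is a POSITIVE scalar multiple of that push-forward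
  (`isMulLeftInvariant_eq_smul`, the scalar `haarScalarFactor μ _` with `haarScalarFactor_pos_of_isHaarMeasure`);
* (7) **`integral_eq_smul_integral_prod`**: for `μ = c • Measure.map e.symm (ν₁.prod ν₂)` and `F` integrable against `μ`,
  `∫ x, F x ∂μ = (c : ℝ) • ∫ a, ∫ b, F (e.symm (a, b)) ∂ν₂ ∂ν₁` (`integral_smul_nnreal_measure`,
  `integral_map_equiv` along the homeomorphism (as a measurable equivalence), `integral_prod`; no `c ≠ 0` hypothesis — at `c = 0` both
  sides are `0`).
At `e := torusSplit W` (resp. `torusSplit' W`) with `(torusSplit W).symm (a, b) = a * b` these are S14382's (5)/(6)/(7)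
verbatim; the adelic objects are NOT mentioned here — this file knows nothing of the cell's tori.

Nothing here says anything about the status of the Hodge conjecture for CM abelian varieties, which is NOT proved
(HC_CM is NOT proved by anyone in this repository).
-/

set_option autoImplicit false

noncomputable section

open MeasureTheory Measure Filter Topology
open scoped NNReal ENNReal

namespace Summit.Ventures.HodgeRepro.Tier4.Common

section HaarProductTransport

variable {G H₁ H₂ : Type*}
  [Group G] [TopologicalSpace G] [IsTopologicalGroup G] [MeasurableSpace G] [BorelSpace G]
  [Group H₁] [TopologicalSpace H₁] [IsTopologicalGroup H₁] [MeasurableSpace H₁] [BorelSpace H₁]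
  [Group H₂] [TopologicalSpace H₂] [IsTopologicalGroup H₂] [MeasurableSpace H₂] [BorelSpace H₂]

/-- **(5) The push-forward of a product of Haar measures along the inverse of a continuous isomorphism `G ≃ₜ* H₁ × H₂`
is a Haar measure on `G`.**  The factors are locally compact and second countable (so that the Haar measures are
σ-finite and the product carries the Borel σ-algebra); `e.symm` is measurable because it is continuous. -/
theorem isHaarMeasure_map_symm_prod
    [LocallyCompactSpace H₁] [SecondCountableTopology H₁] [LocallyCompactSpace H₂] [SecondCountableTopology H₂]
    (e : G ≃ₜ* H₁ × H₂) (ν₁ : Measure H₁) [ν₁.IsHaarMeasure] (ν₂ : Measure H₂) [ν₂.IsHaarMeasure] :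
    (Measure.map e.symm (ν₁.prod ν₂)).IsHaarMeasure :=
  ContinuousMulEquiv.isHaarMeasure_map (ν₁.prod ν₂) e.symm

/-- **(6) Haar uniqueness along `G ≃ₜ* H₁ × H₂`**: a Haar measure `μ` on `G` is a POSITIVE scalar multiple of the push-forward
of `ν₁ ⊗ ν₂` (`G` locally compact and second countable). -/
theorem exists_smul_map_symm_prod_eq
    [LocallyCompactSpace G] [SecondCountableTopology G]
    [LocallyCompactSpace H₁] [SecondCountableTopology H₁] [LocallyCompactSpace H₂] [SecondCountableTopology H₂]
    (e : G ≃ₜ* H₁ × H₂) (μ : Measure G) [μ.IsHaarMeasure]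
    (ν₁ : Measure H₁) [ν₁.IsHaarMeasure] (ν₂ : Measure H₂) [ν₂.IsHaarMeasure] :
    ∃ c : ℝ≥0, 0 < c ∧ μ = c • Measure.map e.symm (ν₁.prod ν₂) := by
  haveI := isHaarMeasure_map_symm_prod e ν₁ ν₂
  exact ⟨haarScalarFactor μ (Measure.map e.symm (ν₁.prod ν₂)), haarScalarFactor_pos_of_isHaarMeasure _ _,
    isMulLeftInvariant_eq_smul _ _⟩

omit [IsTopologicalGroup G] in
/-- **(7) The integral against `μ = c • (e.symm)_*(ν₁ ⊗ ν₂)` is `c` times the iterated integral over `H₁ × H₂`.**  No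
hypothesis on `c`: at `c = 0` both sides vanish. -/
theorem integral_eq_smul_integral_prod
    [LocallyCompactSpace H₁] [SecondCountableTopology H₁] [LocallyCompactSpace H₂] [SecondCountableTopology H₂]
    (e : G ≃ₜ* H₁ × H₂) (μ : Measure G)
    (ν₁ : Measure H₁) [ν₁.IsHaarMeasure] (ν₂ : Measure H₂) [ν₂.IsHaarMeasure]
    (c : ℝ≥0) (hc : μ = c • Measure.map e.symm (ν₁.prod ν₂)) (F : G → ℂ) (hF : Integrable F μ) :
    ∫ x, F x ∂μ = (c : ℝ) • ∫ a, ∫ b, F (e.symm (a, b)) ∂ν₂ ∂ν₁ := by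
  subst hc
  rcases eq_or_ne c 0 with rfl | hc0
  · rw [zero_smul, integral_zero_measure, NNReal.coe_zero, zero_smul]
  · have hmeq : Measure.map e.symm (ν₁.prod ν₂) =
        Measure.map (e.symm.toHomeomorph.toMeasurableEquiv) (ν₁.prod ν₂) := rfl
    have hsm : (c • Measure.map e.symm (ν₁.prod ν₂) : Measure G) =
        ((c : ℝ≥0∞) • Measure.map e.symm (ν₁.prod ν₂)) := Measure.ext fun _ _ => rfl
    have hint : Integrable (fun p : H₁ × H₂ => F (e.symm p)) (ν₁.prod ν₂) := by
      rw [hsm, integrable_smul_measure (by exact_mod_cast hc0) ENNReal.coe_ne_top, hmeq,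
        integrable_map_equiv] at hF
      exact hF
    rw [integral_smul_nnreal_measure, NNReal.smul_def, hmeq, integral_map_equiv]
    congr 1
    exact integral_prod (fun p : H₁ × H₂ => F (e.symm p)) hint

end HaarProductTransport

end Summit.Ventures.HodgeRepro.Tier4.Common
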